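import Literature.AlgebraicGeometry.Resolution.Lipman1969DominationByQuadraticTransforms
import Literature.AlgebraicGeometry.Morphisms.NagataCompactificationProofs
import Literature.AlgebraicGeometry.Resolution.Blowups
import HarnessLib

/-!
# Lipman 1969, proof of Proposition (1.2), statement B) (Zariski's elimination of indeterminacies,
# Theorem (26.1), special case) REDUCED TO the principalization of ideal sheaves on the regular surface

Topic: `Literature/AlgebraicGeometry/Resolution`. PROVED, fact-free, definition-free (hand
leafhand-res-homologicalconduct-16 g2 of the cell decomp-res; AI-written bookkeeping over tree theorems,
weaker than expert review).

`Lipman1969_1_2_B` (`Lipman1969DominationByQuadraticTransforms.lean`) is the named fact «B)» of Lipman's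
proof of Proposition (1.2) (p. 200): for a resolution `f : X → Spec R` of a two-dimensional normal local
domain and a proper birational `g : W → Spec R` (`W` integral) there are `Z` regular, `j : Z → X` a
resolution and `h : Z → W` with `h ≫ g = j ≫ f` — «a special case of Theorem (26.1) (elimination of
indeterminacies)», Zariski.  This file proves it MODULO the classical principalization of ideal sheaves on
the regular surface `X` (Zariski; Kollár 2007, Thm. 1.74 with Rem. 1.78; the termination is Lipman's proof of
Theorem (26.2), p. 274), taken as an explicit HYPOTHESIS (no named fact is introduced):

> (PRINC) for every non-zero ideal sheaf `K` on `X` there is a resolution `j : Z → X` (proper, birational,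
> `Z` regular) with `K·𝒪_Z` an effective Cartier divisor.

The reduction (`exists_dominating_resolution_of_principalization`) is three tree theorems:
1. Stacks 081T (tree `Morphisms.exists_isBlowup_dominating`, unconditional): `g` is dominated by the blowing
   up `b : S′ → Spec R` of an ideal sheaf `𝓘` with `V(𝓘) = Spec R ∖ U`, `U` an open over which `g` (and `f`)
   is an isomorphism: `r : S′ → W`, `r ≫ g = b`;
2. (PRINC) applied to `K := 𝓘·𝒪_X` (non-zero: `f⁻¹U ≠ ∅`) gives `j : Z → X` with `𝓘·𝒪_Z = K·𝒪_Z`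
   effective Cartier (`Scheme.IdealSheafData.comap_comp`);
3. the universal property of blowing up (Görtz–Wedhorn I, Def. 13.90; tree `IsBlowup.lift`) gives
   `ρ : Z → S′` with `ρ ≫ b = j ≫ f`; put `h := ρ ≫ r`.
No normality, no dimension hypothesis and no integrality of `W` are used by the reduction itself.

* `exists_dominating_resolution_of_principalization` — the pointwise reduction (any Noetherian `R ≠ 0`);
* `Lipman1969_1_2_B_of_principalization` — `(PRINC for every resolution of every such R) → Lipman1969_1_2_B`.

What is NOT here: (PRINC) itself (its ingredients in the tree: the divisorial part of an ideal sheaf on a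
regular scheme `Resolution/DivisorialPart`, blowing up closed points of regular surfaces
`Resolution/BlowupClosedPointRegularSurface`, quadratic transforms `Resolution/QuadraticTransforms*`; missing:
the iteration and its termination — along an infinite sequence of quadratic transforms every finitely
generated ideal becomes principal, Abhyankar 1956 Lemma 12 / Lipman (26.2)).  Nothing of Proposition (1.2)
is discharged here; no summit statement is proved.

## References
* J. Lipman, *Rational singularities …*, Publ. Math. IHÉS 36 (1969): proof of Prop. (1.2), statement B)
  (p. 200); Theorems (26.1), (26.2) (p. 274). [Lipman1969]
* J. Kollár, *Lectures on Resolution of Singularities*, Ann. of Math. Studies 166 (2007), Thm. 1.74,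
  Rem. 1.78 (principalization of ideal sheaves on surfaces). [Kollar2007]
* The Stacks Project, Tag 081T. [StacksProject]
* U. Görtz, T. Wedhorn, *Algebraic Geometry I*, 2nd ed. (2020), Def. 13.90 (universal property of blowing
  up). [GortzWedhorn2020]
-/

noncomputable section

open CategoryTheory CategoryTheory.Limits AlgebraicGeometry TopologicalSpace

universe u

namespace Literature.AlgebraicGeometry.Resolution

/-- **B) from principalization, pointwise.** Let `R ≠ 0` be a Noetherian ring, `f : X → Spec R` a resolution
whose source admits principalization of non-zero ideal sheaves by resolutions (hypothesis `hprinc`), and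
`g : W → Spec R` proper and birational.  Then some resolution `j : Z → X` carries a morphism `h : Z → W` with
`h ≫ g = j ≫ f`.  Proof: Stacks 081T dominates `g` by the blowing up `b : S′ → Spec R` of an ideal `𝓘`
cosupported off an open `U` over which `f` and `g` are isomorphisms; `hprinc` makes `𝓘·𝒪_Z` Cartier on a
resolution `Z → X`; the universal property of `b` lifts `Z → Spec R` to `S′ → W`.
[cite: Lipman1969, Proposition (1.2), proof, statement B) (p. 200); Theorem (26.1) (p. 274)]
[cite: StacksProject, Tag 081T] [cite: GortzWedhorn2020, Def. 13.90] -/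
theorem exists_dominating_resolution_of_principalization {R : Type u} [CommRing R] [IsNoetherianRing R]
    [Nontrivial R] {X : Scheme.{u}} {f : X ⟶ Spec (.of R)} (hf : IsResolution f)
    (hprinc : ∀ K : X.IdealSheafData, K ≠ ⊥ →
      ∃ (Z : Scheme.{u}) (j : Z ⟶ X), IsResolution j ∧ IsEffectiveCartier (K.comap j))
    {W : Scheme.{u}} (g : W ⟶ Spec (.of R)) [IsProper g] (hg : IsBirational g) :
    ∃ (Z : Scheme.{u}) (j : Z ⟶ X) (h : Z ⟶ W), IsResolution j ∧ h ≫ g = j ≫ f := by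
  -- a common open `U` over which `g` and `f` are isomorphisms
  obtain ⟨U₁, hU₁, -, hiso₁⟩ := hg
  obtain ⟨U₂, hU₂, -, hiso₂⟩ := hf.isBirational
  haveI : Nonempty (Spec (.of R)) := inferInstanceAs (Nonempty (PrimeSpectrum R))
  have hne : ((U₁ ⊓ U₂ : (Spec (.of R)).Opens) : Set (Spec (.of R))).Nonempty := by
    rw [Opens.coe_inf, Set.inter_comm]
    exact hU₁.inter_open_nonempty U₂ U₂.2 hU₂.nonempty
  set U : (Spec (.of R)).Opens := U₁ ⊓ U₂ with hU
  haveI hgU : IsIso (g ∣_ U) := isIso_morphismRestrict_of_le _ hiso₁ inf_le_left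
  haveI hfU : IsIso (f ∣_ U) := isIso_morphismRestrict_of_le _ hiso₂ inf_le_right
  -- `f⁻¹U` is non-empty
  have hfne : ((f ⁻¹ᵁ U : X.Opens) : Set X).Nonempty := by
    obtain ⟨x, hx⟩ := hne
    let y : ↥(f ⁻¹ᵁ U) := (Scheme.homeoOfIso (asIso (f ∣_ U))).symm ⟨x, hx⟩
    exact ⟨y, y.2⟩
  -- Stacks 081T: a blowing up of `Spec R` off `U` dominating `g`
  haveI : IsProper f := hf.isProper
  obtain ⟨I, S', b, r, -, hsupp, hb, hcomp, -⟩ :=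
    Literature.AlgebraicGeometry.Morphisms.exists_isBlowup_dominating g U
      (NoetherianSpace.isCompact _)
  -- `K := 𝓘·𝒪_X` is non-zero
  have hKsupp : ((I.comap f).support : Set X) = ((f ⁻¹ᵁ U : X.Opens) : Set X)ᶜ := by
    rw [Scheme.IdealSheafData.support_comap, Closeds.coe_preimage, hsupp, Set.preimage_compl]
    rfl
  have hK : I.comap f ≠ ⊥ := by
    intro h
    obtain ⟨x, hx⟩ := hfne
    have hx' : x ∈ ((I.comap f).support : Set X) := by
      rw [h, Scheme.IdealSheafData.support_bot]; trivial
    rw [hKsupp] at hx'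
    exact hx' hx
  -- principalization on `X`
  obtain ⟨Z, j, hj, hcart⟩ := hprinc (I.comap f) hK
  have hcart' : IsEffectiveCartier (I.comap (j ≫ f)) := by
    rw [Scheme.IdealSheafData.comap_comp]
    exact hcart
  -- universal property of the blowing up `b`
  refine ⟨Z, j, hb.lift (j ≫ f) hcart' ≫ r, hj, ?_⟩
  rw [Category.assoc, hcomp, hb.lift_comp]

/-- **Lipman 1969, statement B) of the proof of Proposition (1.2) — from principalization of ideal sheaves
on regular surfaces.**  If every resolution `X → Spec R` of a two-dimensional normal Noetherian local domain
admits principalization of its non-zero ideal sheaves by resolutions (Zariski; Kollár 2007 Thm. 1.74 /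
Rem. 1.78 — hypothesis `hprinc`), then `Lipman1969_1_2_B` holds.
[cite: Lipman1969, Proposition (1.2), proof, statement B) (p. 200); Theorem (26.1) (p. 274)]
[cite: Kollar2007, Thm. 1.74 and Rem. 1.78] -/
theorem Lipman1969_1_2_B_of_principalization
    (hprinc : ∀ (R : Type u) [CommRing R] [IsNoetherianRing R] [IsLocalRing R] [IsDomain R]
      [IsIntegrallyClosed R], ringKrullDim R = 2 →
      ∀ (X : Scheme.{u}) (f : X ⟶ Spec (.of R)), IsResolution f →
      ∀ K : X.IdealSheafData, K ≠ ⊥ →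
        ∃ (Z : Scheme.{u}) (j : Z ⟶ X), IsResolution j ∧ IsEffectiveCartier (K.comap j)) :
    Lipman1969_1_2_B.{u} := by
  intro R _ _ _ _ _ hR X f hf W _ g _ hg
  exact exists_dominating_resolution_of_principalization hf (hprinc R hR X f hf) g hg

end Literature.AlgebraicGeometry.Resolution

end
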